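import Summits.BirchSwinnertonDyer.BirchSwinnertonDyer.Theorems.KatoDescentPotSupersingularMemberHullZetaInputsOfCorePrelim
import Summits.BirchSwinnertonDyer.BirchSwinnertonDyer.Theorems.KatoDescentPotSupersingularStrictSelmerBridge
import Summits.BirchSwinnertonDyer.BirchSwinnertonDyer.Theorems.KatoDescentPotSupersingularIntegralH1LayerZeroTop
import Summits.BirchSwinnertonDyer.BirchSwinnertonDyer.Theorems.KatoDescentPotSupersingularASideIndexHypothesis
import Summits.BirchSwinnertonDyer.BirchSwinnertonDyer.Theorems.KatoDescentPotSupersingularIntegralH1RankZero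
import Summits.BirchSwinnertonDyer.Rank1Residual.X12.O11.LocalKernelFiniteAtThreeDischarge
import Literature.NumberTheory.EllipticCurves.Kato2004.MemberHullZetaCoreInputs
import Literature.NumberTheory.EllipticCurves.HasseWeilGoodReduction
import HarnessLib

/-!
# Crux M re-keyed (planner TARGET R265, T2): the held CORE package implies the held ZETA package —
# `MemberHullZetaCoreInputs → (Poitou–Tate) → MemberHullZetaInputs` on every pin with `W(ℚ)`, `Ш(W)[p^∞]` finite, and
# `exists_memberHullZetaCoreInputs → poitouTate_selmerStructure_duality ℚ → GZK → exists_memberHullZetaInputs`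
# (route `KatoDescentPotSupersingular` / `…Tame…`, crux M = stmt-BirchSwinnertonDyer-19196; route-free node)

Seat `bsd-potss-rkm` g21 (prover; cell `bsd-potss`), item stmt-BirchSwinnertonDyer-19196 `ReducibleKatoMember` (`--supports … --as helper`;
closes nothing).  HONEST FRAMING: BSD is not proved by any of this; nothing is booked; theorems only (no definition, no named fact).  The held
named facts `Kato2004.exists_memberHullZetaCoreInputs` (p630270), `poitouTate_selmerStructure_duality ℚ` and
`rank_eq_analyticRank_of_analyticRank_le_one` are HYPOTHESES here (cite-level published inputs), never asserted.

## What

The two clauses by which the zeta package `Kato2004.MemberHullZetaInputs` (held child stmt-BirchSwinnertonDyer-20297) exceeds the core package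
`Kato2004.MemberHullZetaCoreInputs` are theorems of the core package:

* `index_ne_zero` (Kato Thm. 14.5 (2)): a class whose zeta line has local index at least `p^e` at `p` (clause (b′), `ZetaLineOrthIndexAt`) is not
  torsion (`not_isOfFinAddOrder_of_zetaLineOrthIndexAt`: at a level `p^k > ord(y₀)·p^e` the class `ord(y₀)·y₀ = 0` is orthogonal to everything), hence
  `[A : Λ·ι(𝐲̄)] ≠ 0` by (R0) (`MemberIndexOfValue.IwasawaH2Data.natCard_quotient_span_ne_zero_of_not_isOfFinAddOrder`);
* `count` (Prop. 14.16 (2)) — **`MemberHullZetaCoreInputs.count_of_zetaLineIndex_of_katoH2Count`**: part 58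
  (`tamagawa_mul_sha_mul_index_le_ppart_of_zetaLineOrthIndexAt`, the level-`0` Poitou–Tate count modulo `poitouTate_selmerStructure_duality ℚ`)
  at the zeta line `ℤ_p · layerZeroToTop (proj₀ 𝐲)` (index = `[A : Λ·ι(𝐲̄)]`, part 60), with `#Sel_str^{ur}` read in the Literature currency (part 59)
  and replaced through clause (c2′) `KatoH2CountAt` by `#(𝐇²/X𝐇²)·#W(ℚ)[p^∞]/#W(ℚ_p)[p^∞]`; all factors are powers of `p` (§1), so the
  inequality of naturals is the printed inequality of `ord_p`'s.

Hence **`MemberHullZetaCoreInputs.nonempty_memberHullZetaInputs`** and **`exists_memberHullZetaInputs_of_coreInputs`** (the member's `W_K(ℚ)` is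
finite by Gross–Zagier–Kolyvagin at `W` transported along the isogeny, `Ш(W_K)` finite likewise — as in `Kato2004.exists_memberHullInputs_of_zetaInputs`).
With the landed closers of the zeta family (`Theorems.reducibleKatoMember_of_newformZ_of_zetaInputs`, glue items 20299/20300) crux M follows from
{modularity, `exists_memberHullZetaCoreInputs`, `poitouTate_selmerStructure_duality ℚ`, GZK}: typed closers in
`Theorems/KatoDescent{,Tame}PotSupersingularReducibleKatoMemberOfCoreInputs.lean`.

References: K. Kato, Astérisque 295 (2004), Thm. 14.5 (2) (p. 236), (14.9.3) (p. 240), §14.14 (14.14.1)–(14.14.2) (p. 243), Prop. 14.16 (2) and its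
proof (pp. 244–245), Lemma 14.18 (pp. 247–248) [Kato2004Asterisque]; C.-H. Kim, AJM 148 (2026) §3.2.3 [Kim2022StructureSelmer]; J. S. Milne, *ADT*
I Cor. 2.3, Thm. 4.10 (b) [MilneADT2006]; H. Darmon, CBMS 101 Thm. 3.22 [Darmon2004]; J. H. Silverman, *AEC* VII.6.3 [SilvermanAEC2009]
(`W(ℚ_p)[p^∞]` finite: tree `X12.O11.finite_primaryComponent_point_adicCompletion`).
-/

-- the summit and its single problem are both named `BirchSwinnertonDyer` (registry layout D-0017)
set_option linter.dupNamespace false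
set_option autoImplicit false

noncomputable section

open scoped Classical ContRepresentation NumberField TensorProduct
open CategoryTheory Function Field NumberField IsDedekindDomain WeierstrassCurve CongruenceSubgroup
open Literature.NumberTheory.EllipticCurves Literature.NumberTheory.GaloisRepresentations
  Literature.NumberTheory.GaloisRepresentations.DiscreteGaloisModule Literature.NumberTheory.GaloisCohomology
open Literature.NumberTheory.EllipticCurves.ModularForms
open Literature.NumberTheory.EllipticCurves.Kato2004 Literature.NumberTheory.EllipticCurves.Kato2004.EulerSystemValues
open Literature.NumberTheory.EllipticCurves.IwasawaAlgebra Rat.HeightOneSpectrum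
open Summit.BirchSwinnertonDyer.Rank1Residual.X11b.Levels Summit.BirchSwinnertonDyer.Rank1Residual.X11b.LocBridge
  Summit.BirchSwinnertonDyer.Rank1Residual.X11b.AcSelmer
open Summit.BirchSwinnertonDyer.BirchSwinnertonDyer.Theorems.ASideJunction
open Summit.BirchSwinnertonDyer.BirchSwinnertonDyer.Theorems.KatoFiniteLevelCount
open Summit.BirchSwinnertonDyer.BirchSwinnertonDyer.Theorems.StrictSelmerBridge
open Summit.BirchSwinnertonDyer.BirchSwinnertonDyer.Theorems.IntegralH1LayerZeroTop
open Summit.BirchSwinnertonDyer.BirchSwinnertonDyer.Theorems.MemberIndexOfValue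

namespace Summit.BirchSwinnertonDyer.BirchSwinnertonDyer.Theorems.MemberHullZetaInputsOfCore

/-! ## §4 The two dropped clauses are theorems of the core package -/

section Core

variable {W : WeierstrassCurve ℚ} [W.IsElliptic] {p : ℕ} [Fact p.Prime]
  [ContinuousSMul ℤ_[p] (W.tateModule p)] {κ : ZpExtension ℚ p} {γ : absoluteGaloisGroup ℚ}
  {I : IwasawaH1Data W p κ γ} {y : I.H}

/-- `ι` of a core package is injective (`κ` cyclotomic, `γ` a topological generator): the pin `toH1 (ι (mk x)) = proj₀ x` and
`TwistTate.mem_TSubmodule_of_proj_zero_eq_zero` (as `MemberHullZetaInputs.ι_injective`). [cite: Kato2004Asterisque, §14.14 (14.14.1) (p. 243)] -/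
theorem _root_.Literature.NumberTheory.EllipticCurves.Kato2004.MemberHullZetaCoreInputs.ι_injective
    (Z : MemberHullZetaCoreInputs W p κ γ I y) (hκ : κ.IsCyclotomic) (hγ : κ.IsTopGenerator γ) : Function.Injective Z.ι := by
  rw [injective_iff_map_eq_zero]
  intro x hx
  induction x using Submodule.Quotient.induction_on with
  | H x =>
    have h0 : I.proj 0 x = 0 := by rw [← Z.toH1_ι x, hx, map_zero]
    exact (Submodule.Quotient.mk_eq_zero _).mpr (TwistTate.mem_TSubmodule_of_proj_zero_eq_zero W p κ hκ hγ I x h0)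

/-- The `(H2, A, toH1, ι, π)`-fields of a core package form a descent package `IwasawaH2Data W p κ γ I`.
[cite: Kato2004Asterisque, §14.14 (14.14.1) (p. 243)] -/
theorem _root_.Literature.NumberTheory.EllipticCurves.Kato2004.MemberHullZetaCoreInputs.exists_iwasawaH2Data
    (Z : MemberHullZetaCoreInputs W p κ γ I y) (hκ : κ.IsCyclotomic) (hγ : κ.IsTopGenerator γ) :
    ∃ D : IwasawaH2Data W p κ γ I, D.H2 = Z.H2 ∧ HEq D.A Z.A ∧
      Nat.card (D.A ⧸ (IwasawaAlgebra p) ∙ D.ι (Submodule.Quotient.mk y)) =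
        Nat.card (Z.A ⧸ (IwasawaAlgebra p) ∙ Z.ι (Submodule.Quotient.mk y)) ∧
      Nat.card (coinvariants p D.H2) = Nat.card (coinvariants p Z.H2) :=
  ⟨{ H2 := Z.H2, finite_H2 := Z.finite_H2, isTorsion_H2 := Z.isTorsion_H2, A := Z.A, toH1 := Z.toH1,
     toH1_injective := Z.toH1_injective, mem_range_toH1_iff := Z.mem_range_toH1_iff, toH1_smul := Z.toH1_smul, ι := Z.ι, π := Z.π,
     ι_injective := Z.ι_injective hκ hγ, π_surjective := Z.π_surjective, exact_ι_π := Z.exact_ι_π, toH1_ι := Z.toH1_ι },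
    rfl, HEq.rfl, rfl, rfl⟩

variable [Finite W.toAffine.Point] [Finite (AddCommGroup.primaryComponent W.sha p)]

/-- **Thm. 14.5 (2) on a core package: `[A : Λ·ι(𝐲̄)] ≠ 0`** (`W(ℚ)`, `Ш[p^∞]` finite; `κ` cyclotomic, `γ` a generator; one Poitou–Tate family to
instantiate (b′)): the zeta line has a local index at `p` (clause (b′)), so `proj₀ 𝐲` is not torsion (§3), and (R0) + rank bookkeeping give the
finite index (`MemberIndexOfValue.IwasawaH2Data.natCard_quotient_span_ne_zero_of_not_isOfFinAddOrder`). [cite: Kato2004Asterisque, Thm. 14.5 (2) (p. 236)] -/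
theorem _root_.Literature.NumberTheory.EllipticCurves.Kato2004.MemberHullZetaCoreInputs.index_ne_zero_of_PT
    (Z : MemberHullZetaCoreInputs W p κ γ I y) (hκ : κ.IsCyclotomic) (hγ : κ.IsTopGenerator γ)
    (hPT : poitouTate_selmerStructure_duality ℚ) :
    Nat.card (Z.A ⧸ (IwasawaAlgebra p) ∙ Z.ι (Submodule.Quotient.mk y)) ≠ 0 := by
  obtain ⟨D, -, -, hDA, -⟩ := Z.exists_iwasawaH2Data hκ hγ
  obtain ⟨q, -, e, -, hZL⟩ := Z.zetaLineIndex
  have hnt : ¬ IsOfFinAddOrder (layerZeroToTop W p κ (I.proj 0 y)) := not_isOfFinAddOrder_of_zetaLineOrthIndexAt W p hPT hZL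
  have hnt0 : ¬ IsOfFinAddOrder (I.proj 0 y) := by
    intro h
    obtain ⟨n, hn, hny⟩ := h.exists_nsmul_eq_zero
    exact hnt (isOfFinAddOrder_iff_nsmul_eq_zero.mpr ⟨n, hn, by
      rw [← map_nsmul (layerZeroToTop W p κ).hom, hny, map_zero]⟩)
  rw [← hDA]
  exact IwasawaH2Data.natCard_quotient_span_ne_zero_of_not_isOfFinAddOrder D hnt0

/-- **Prop. 14.16 (2) — the COUNT — on a core package** (`W(ℚ)`, `Ш[p^∞]` finite; `p` odd; `κ` cyclotomic, `γ` a generator; the named fact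
`poitouTate_selmerStructure_duality ℚ`):
`ord_p #Ш(W)[p^∞] + v_p(Tam W) + ord_p [A : Λ·ι(𝐲̄)] ≤ ord_p(L(W,1)/Ω(W)) + v_p(λ(0)) + ord_p #(𝐇²/X𝐇²) + 3·ord_p #W(ℚ)_tors`, VERBATIM the `count` clause
of `Kato2004.MemberHullZetaInputs`, from (b′) `zetaLineIndex` and (c2′) `katoH2Count`: part 58 at the zeta line `ℤ_p · layerZeroToTop (proj₀ 𝐲)`
(whose index is `[A : Λ·ι(𝐲̄)]`, part 60; `p^N A ⊆ ℤ_p y₀` from the finite index, part 57), `#Sel_str^{ur}` moved to the Literature currency (part 59)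
and eliminated through (c2′); every factor is a power of `p` (§1), `#W(ℚ)[p^∞] ∣ #W(ℚ)_tors` absorbs into the third torsion copy.
[cite: Kato2004Asterisque, Prop. 14.16 (2) and its proof (pp. 244–245), (14.9.3) (p. 240), (14.14.2) (p. 243), Lemma 14.18 (pp. 247–248)]
[cite: Kim2022StructureSelmer, §3.2.3 display before Thm. 3.7 (PDF p. 16)] [cite: MilneADT2006, Ch. I, Cor. 2.3, Thm. 4.10 (b)] -/
theorem _root_.Literature.NumberTheory.EllipticCurves.Kato2004.MemberHullZetaCoreInputs.count_of_zetaLineIndex_of_katoH2Count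
    (Z : MemberHullZetaCoreInputs W p κ γ I y) (hκ : κ.IsCyclotomic) (hγ : κ.IsTopGenerator γ)
    (hPT : poitouTate_selmerStructure_duality ℚ) (hodd : p ≠ 2) :
    ∃ q : ℚ, W.entireLFunction 1 / (W.realPeriodRat : ℂ) = (q : ℂ) ∧
      (padicValNat p (Nat.card (AddCommGroup.primaryComponent W.sha p)) : ℤ) +
          padicValNat p W.tamagawaProduct +
          padicValNat p (Nat.card (Z.A ⧸ (IwasawaAlgebra p) ∙ Z.ι (Submodule.Quotient.mk y))) ≤
        padicValRat p q + ((PowerSeries.constantCoeff Z.lam).valuation : ℤ) +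
          padicValNat p (Nat.card (coinvariants p Z.H2)) + 3 * (padicValNat p W.torsionOrder : ℤ) := by
  have hp : p.Prime := Fact.out
  obtain ⟨D, hDH2, -, hDA, hDH2card⟩ := Z.exists_iwasawaH2Data hκ hγ
  obtain ⟨q, hq, e, he, hZL⟩ := Z.zetaLineIndex
  refine ⟨q, hq, ?_⟩
  -- the zeta line at `⊤`
  set y₀ : H1 (tateRep W p) ⊤ := layerZeroToTop W p κ (I.proj 0 y) with hy₀def
  have hy₀ : y₀ ∈ integralH1 (tateRep W p) p ⊤ := layerZeroToTop_mem_integralH1 W p κ (I.proj_mem 0 y)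
  -- the index `[A : Λ·ι(𝐲̄)] = [integralH1_⊤ : ℤ_p y₀] ≠ 0`
  have hidx : Nat.card (Z.A ⧸ (IwasawaAlgebra p) ∙ Z.ι (Submodule.Quotient.mk y)) ≠ 0 := Z.index_ne_zero_of_PT hκ hγ hPT
  have hrel : Nat.card (Z.A ⧸ (IwasawaAlgebra p) ∙ Z.ι (Submodule.Quotient.mk y)) =
      (ℤ_[p] ∙ y₀).toAddSubgroup.relIndex (integralH1 (tateRep W p) p ⊤).toAddSubgroup := by
    rw [← hDA]; exact IwasawaH2Data.natCard_quotient_eq_relIndex_top D y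
  have hrel0 : (ℤ_[p] ∙ y₀).toAddSubgroup.relIndex (integralH1 (tateRep W p) p ⊤).toAddSubgroup ≠ 0 := hrel ▸ hidx
  obtain ⟨N, hN⟩ := exists_pow_smul_mem_span_singleton_of_relIndex_ne_zero (integralH1 (tateRep W p) p ⊤) y₀ hy₀ hrel0
  -- the strict-unramified and relaxed-unramified structures, the finite set of bad places
  obtain ⟨𝓢inf, hSp, hSur, hSinl⟩ : ∃ 𝓢 : SelmerStructure (primaryGaloisModule W p),
      𝓢 (Sum.inr (primePlace p)) = ⊥ ∧
      (∀ v : HeightOneSpectrum (𝓞 ℚ), v ≠ primePlace p →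
        𝓢 (Sum.inr v) = unramifiedSubgroup (GaloisRep.toLocal v (primaryGaloisModule W p)) 1) ∧
      ∀ w : InfinitePlace ℚ, 𝓢 (Sum.inl w) = ⊤ :=
    ⟨fun v => match v with
      | Sum.inl _ => ⊤
      | Sum.inr v => if v = primePlace p then ⊥ else unramifiedSubgroup (GaloisRep.toLocal v (primaryGaloisModule W p)) 1,
     if_pos rfl, fun v hv => if_neg hv, fun _ => rfl⟩
  obtain ⟨𝓤inf, hUp, hUur, hUinl⟩ : ∃ 𝓤 : SelmerStructure (primaryGaloisModule W p),
      𝓤 (Sum.inr (primePlace p)) = ⊤ ∧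
      (∀ v : HeightOneSpectrum (𝓞 ℚ), v ≠ primePlace p →
        𝓤 (Sum.inr v) = unramifiedSubgroup (GaloisRep.toLocal v (primaryGaloisModule W p)) 1) ∧
      ∀ w : InfinitePlace ℚ, 𝓤 (Sum.inl w) = ⊤ :=
    ⟨fun v => match v with
      | Sum.inl _ => ⊤
      | Sum.inr v => if v = primePlace p then ⊤ else unramifiedSubgroup (GaloisRep.toLocal v (primaryGaloisModule W p)) 1,
     if_pos rfl, fun v hv => if_neg hv, fun _ => rfl⟩
  obtain ⟨S, hS⟩ : ∃ S : Finset (HeightOneSpectrum (𝓞 ℚ)), ∀ v, v ∉ S → W.HasGoodReductionAt v := by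
    have h := WeierstrassCurve.eventually_hasGoodReductionAt W
    rw [Filter.eventually_cofinite] at h
    exact ⟨h.toFinset, fun v hv => by_contra fun hbad => hv (h.mem_toFinset.mpr hbad)⟩
  -- part 58: the level-0 count in naturals
  have h58 := tamagawa_mul_sha_mul_index_le_ppart_of_zetaLineOrthIndexAt W p 𝓤inf 𝓢inf hPT hodd (insert (primePlace p) S)
    (Finset.mem_insert_self _ _) (fun v hv => hS v fun h => hv (Finset.mem_insert_of_mem h)) hUp hUur hUinl hSp hSur hSinl y₀ hy₀ N hN e hZL
  -- part 59 and (c2′)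
  have h59 : Nat.card 𝓢inf.selmerGroup = Nat.card (katoStrictSelmer W p {primePlace p}) :=
    natCard_selmerGroup_eq_natCard_katoStrictSelmer W p 𝓢inf hSp hSur hSinl
  have hc2 : Nat.card (coinvariants p Z.H2) * Nat.card (AddCommGroup.primaryComponent W.toAffine.Point p) =
      Nat.card (katoStrictSelmer W p {primePlace p}) *
        Nat.card (AddCommGroup.primaryComponent (W.baseChange ((primePlace p).adicCompletion ℚ)).toAffine.Point p) := Z.katoH2Count
  -- every factor is a power of `p`
  obtain ⟨s, hs⟩ := natCard_primaryComponent_eq_prime_pow p (G := ↥W.sha)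
  obtain ⟨t₀, ht₀⟩ := natCard_primaryComponent_eq_prime_pow p (G := W.toAffine.Point)
  haveI := Summit.BirchSwinnertonDyer.Rank1Residual.X12.O11.finite_primaryComponent_point_adicCompletion W p (primePlace p)
  obtain ⟨tp, htp⟩ := natCard_primaryComponent_eq_prime_pow p (G := (W.baseChange ((primePlace p).adicCompletion ℚ)).toAffine.Point)
  -- the index is a power of `p`
  have hrelQ : (ℤ_[p] ∙ y₀).toAddSubgroup.relIndex (integralH1 (tateRep W p) p ⊤).toAddSubgroup =
      Nat.card (integralH1 (tateRep W p) p ⊤ ⧸ (ℤ_[p] ∙ (⟨y₀, hy₀⟩ : integralH1 (tateRep W p) p ⊤))) :=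
    (natCard_quotient_span_eq_relIndex _ y₀ hy₀).symm
  haveI : Finite (integralH1 (tateRep W p) p ⊤ ⧸ (ℤ_[p] ∙ (⟨y₀, hy₀⟩ : integralH1 (tateRep W p) p ⊤))) :=
    Nat.finite_of_card_ne_zero (hrelQ ▸ hrel0)
  obtain ⟨i, hi⟩ := natCard_eq_prime_pow_of_finite_module p ℤ_[p]
    (integralH1 (tateRep W p) p ⊤ ⧸ (ℤ_[p] ∙ (⟨y₀, hy₀⟩ : integralH1 (tateRep W p) p ⊤)))
  rw [← hrelQ] at hi
  -- `#Sel_str ≠ 0` (the left-hand side of part 58 is positive), hence `n = #(𝐇²/X𝐇²) ≠ 0` and `n` is a power of `p`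
  have hLHS : 0 < p ^ padicValNat p W.tamagawaProduct * Nat.card (AddCommGroup.primaryComponent (↥W.sha) p) *
      (ℤ_[p] ∙ y₀).toAddSubgroup.relIndex (integralH1 (tateRep W p) p ⊤).toAddSubgroup :=
    Nat.mul_pos (Nat.mul_pos (pow_pos hp.pos _) Nat.card_pos) (Nat.pos_of_ne_zero hrel0)
  have hSel0 : Nat.card (katoStrictSelmer W p {primePlace p}) ≠ 0 := by
    intro h0
    rw [h59, h0] at h58
    simp only [mul_zero, zero_mul] at h58
    omega
  have hn0 : Nat.card (coinvariants p Z.H2) ≠ 0 := by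
    intro h0
    rw [h0, zero_mul] at hc2
    exact (mul_ne_zero hSel0 (htp ▸ pow_ne_zero tp hp.ne_zero)) hc2.symm
  haveI : Finite (coinvariants p Z.H2) := Nat.finite_of_card_ne_zero hn0
  obtain ⟨ν, hν⟩ := natCard_eq_prime_pow_of_finite_module p (IwasawaAlgebra p) (coinvariants p Z.H2)
  -- the inequality of exponents
  have hmain : padicValNat p W.tamagawaProduct + s + i + tp ≤
      padicValNat p ((W.baseChange ((primePlace p).adicCompletion ℚ)).localTamagawaNumber ((primePlace p).adicCompletionIntegers ℚ)) +
        ν + t₀ + e + 2 * padicValNat p W.torsionOrder := by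
    apply (Nat.pow_le_pow_iff_right hp.one_lt).mp
    have h1 := Nat.mul_le_mul_right (p ^ tp) h58
    rw [h59, hs, hi] at h1
    calc p ^ (padicValNat p W.tamagawaProduct + s + i + tp)
        = p ^ padicValNat p W.tamagawaProduct * p ^ s * p ^ i * p ^ tp := by simp only [pow_add]
      _ ≤ p ^ padicValNat p ((W.baseChange ((primePlace p).adicCompletion ℚ)).localTamagawaNumber
              ((primePlace p).adicCompletionIntegers ℚ)) * Nat.card (katoStrictSelmer W p {primePlace p}) * p ^ e *
            (p ^ padicValNat p W.torsionOrder) ^ 2 * p ^ tp := h1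
      _ = p ^ padicValNat p ((W.baseChange ((primePlace p).adicCompletion ℚ)).localTamagawaNumber
              ((primePlace p).adicCompletionIntegers ℚ)) * p ^ e * (p ^ padicValNat p W.torsionOrder) ^ 2 *
            (Nat.card (katoStrictSelmer W p {primePlace p}) *
              Nat.card (AddCommGroup.primaryComponent (W.baseChange ((primePlace p).adicCompletion ℚ)).toAffine.Point p)) := by
          rw [htp]; ring
      _ = p ^ padicValNat p ((W.baseChange ((primePlace p).adicCompletion ℚ)).localTamagawaNumber
              ((primePlace p).adicCompletionIntegers ℚ)) * p ^ e * (p ^ padicValNat p W.torsionOrder) ^ 2 * (p ^ ν * p ^ t₀) := by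
          rw [← hc2, hν, ht₀]
      _ = p ^ (padicValNat p ((W.baseChange ((primePlace p).adicCompletion ℚ)).localTamagawaNumber
              ((primePlace p).adicCompletionIntegers ℚ)) + ν + t₀ + e + 2 * padicValNat p W.torsionOrder) := by
          simp only [pow_add, pow_mul]; ring
  -- `t₀ ≤ v_p #W(ℚ)_tors`
  have htO : Nat.card (AddCommGroup.torsion W.toAffine.Point) = W.torsionOrder := by
    unfold WeierstrassCurve.torsionOrder; convert rfl
  have ht₀le : t₀ ≤ padicValNat p W.torsionOrder := by
    have hdvd : Nat.card (AddCommGroup.primaryComponent W.toAffine.Point p) ∣ Nat.card (AddCommGroup.torsion W.toAffine.Point) :=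
      AddSubgroup.card_dvd_of_le fun x hx => by
        obtain ⟨k, hk⟩ := (AddCommGroup.mem_primaryComponent (p := p)).mp hx
        rw [AddCommGroup.mem_torsion]
        exact isOfFinAddOrder_iff_nsmul_eq_zero.mpr ⟨p ^ k, pow_pos hp.pos k, hk⟩
    rw [ht₀, htO] at hdvd
    exact (padicValNat_dvd_iff_le (htO ▸ Nat.card_pos.ne')).mp hdvd
  -- the exponents of the package
  have hSha : padicValNat p (Nat.card (AddCommGroup.primaryComponent W.sha p)) = s := by rw [hs, padicValNat.prime_pow]
  have hIdx : padicValNat p (Nat.card (Z.A ⧸ (IwasawaAlgebra p) ∙ Z.ι (Submodule.Quotient.mk y))) = i := by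
    rw [hrel, hi, padicValNat.prime_pow]
  have hH2 : padicValNat p (Nat.card (coinvariants p Z.H2)) = ν := by rw [hν, padicValNat.prime_pow]
  have hTp : padicValNat p (Nat.card (AddCommGroup.primaryComponent
      (W.baseChange ((primePlace p).adicCompletion ℚ)).toAffine.Point p)) = tp := by rw [htp, padicValNat.prime_pow]
  rw [hSha, hIdx, hH2]
  rw [hTp] at he
  push_cast at hmain he ⊢
  have hmain' : (padicValNat p W.tamagawaProduct : ℤ) + s + i + tp ≤
      (padicValNat p ((W.baseChange ((primePlace p).adicCompletion ℚ)).localTamagawaNumber ((primePlace p).adicCompletionIntegers ℚ)) : ℤ) +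
        ν + t₀ + e + 2 * padicValNat p W.torsionOrder := by exact_mod_cast hmain
  have ht₀le' : (t₀ : ℤ) ≤ padicValNat p W.torsionOrder := by exact_mod_cast ht₀le
  linarith

/-- **The core package gives the zeta package on every pin with `W(ℚ)`, `Ш(W)[p^∞]` finite** (`p` odd, `κ` cyclotomic, `γ` a generator; modulo the
Poitou–Tate named fact): `index_ne_zero` and `count` supplied by the two theorems above, the other fields verbatim
(`MemberHullZetaCoreInputs.toMemberHullZetaInputs`). [cite: Kato2004Asterisque, Thm. 14.5 (2) (p. 236) and Prop. 14.16 (2) (p. 244)] -/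
theorem _root_.Literature.NumberTheory.EllipticCurves.Kato2004.MemberHullZetaCoreInputs.nonempty_memberHullZetaInputs
    (Z : MemberHullZetaCoreInputs W p κ γ I y) (hκ : κ.IsCyclotomic) (hγ : κ.IsTopGenerator γ)
    (hPT : poitouTate_selmerStructure_duality ℚ) (hodd : p ≠ 2) : Nonempty (MemberHullZetaInputs W p κ γ I y) :=
  ⟨Z.toMemberHullZetaInputs (Z.index_ne_zero_of_PT hκ hγ hPT) (Z.count_of_zetaLineIndex_of_katoH2Count hκ hγ hPT hodd)⟩

end Core

/-! ## §5 The held core fact gives the held zeta fact -/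

section Facts

/-- `L(W,1) ≠ 0` forces analytic rank `0` (junk branch included). [cite: BirchSwinnertonDyer1965] -/
private theorem analyticRank_eq_zero_of_L_one_ne_zero (W : WeierstrassCurve ℚ) [W.IsElliptic]
    (hL : W.entireLFunction 1 ≠ 0) : W.analyticRank = 0 := by
  by_cases hE : W.HasEntireLFunction
  · exact (WeierstrassCurve.analyticRank_eq_zero_iff_holds (W := W) hE).mpr hL
  · exact W.analyticRank_eq_zero_of_not_hasEntireLFunction hE

/-- **`exists_memberHullZetaCoreInputs → exists_memberHullZetaInputs`, given Gross–Zagier–Kolyvagin (`W(ℚ)` finite when `L(W,1) ≠ 0`, transported to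
the member along the isogeny) and the Poitou–Tate named fact** — the re-key of crux M's held child 20297 to the core package (planner TARGET R265):
on each pin of the member, `W_K(ℚ)` and `Ш(W_K)` are finite, so `nonempty_memberHullZetaInputs` applies.
[cite: Kato2004Asterisque, Thm. 14.5 (2) (p. 236), Prop. 14.16 (2) (pp. 244–245), Lemma 14.18 (pp. 247–248), (14.14.2) (p. 243)]
[cite: Darmon2004, Thm. 3.22 (= Thm. 1.14) and §3.9] [cite: MilneADT2006, Ch. I, Thm. 4.10 (b)] -/
theorem exists_memberHullZetaInputs_of_coreInputs (hGZK : rank_eq_analyticRank_of_analyticRank_le_one)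
    (hPT : poitouTate_selmerStructure_duality ℚ) (h : exists_memberHullZetaCoreInputs) : exists_memberHullZetaInputs := by
  intro W _ _ p _ hp hgood hmult hj hirr hL hsha
  obtain ⟨W', hW'e, hW'm, hiso, hrest⟩ := h W p hp hgood hmult hj hirr hL hsha
  haveI := hW'e
  -- `W(ℚ)` is finite: analytic rank `0` and Gross–Zagier–Kolyvagin; transported along the isogeny to the member
  have h0 : W.analyticRank = 0 := analyticRank_eq_zero_of_L_one_ne_zero W hL
  obtain ⟨hrk, -⟩ := hGZK W (by rw [h0]; exact zero_le_one)
  rw [h0] at hrk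
  haveI hWfin : Finite W.toAffine.Point := (W.mordellWeilRank_eq_zero_iff_finite).mp hrk
  haveI hW'fin : Finite W'.toAffine.Point := finite_point_of_isIsogenous hiso.symm_of_isElliptic hWfin
  have hshaW' : W'.ShaFinite := hiso.shaFinite_iff_shaFinite.mp hsha
  haveI : Finite W'.sha := hshaW'
  refine ⟨W', hW'e, hW'm, hiso, ?_⟩
  intro _ _ _ N _ f hf ι
  obtain ⟨κ', Λ', c, d, a, A, z, x, hκ', hA, hc, hd, hZB, hall⟩ := hrest f hf ι
  refine ⟨κ', Λ', c, d, a, A, z, x, hκ', hA, hc, hd, hZB, ?_⟩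
  intro κ γ hκ hγ I y hy
  obtain ⟨Z⟩ := hall κ γ hκ hγ I y hy
  exact Z.nonempty_memberHullZetaInputs hκ hγ hPT hp

end Facts

end Summit.BirchSwinnertonDyer.BirchSwinnertonDyer.Theorems.MemberHullZetaInputsOfCore

end
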